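import Summits.AtomisticToContinuum.HydrodynamicLimit.Theorems.RelayRaceLocalityNearConstantShortTimeHLAssemblyTheta
import Summits.AtomisticToContinuum.HydrodynamicLimit.Theorems.RelayRaceLocalityNearConstantShortTimeHLBallKinetics
import Summits.AtomisticToContinuum.HydrodynamicLimit.Theorems.RelayRaceLocalityNearConstantShortTimeHLCommutators
import HarnessLib

/-!
# Crux `NearConstantShortTimeHL` (stmt-AtomisticToContinuum-12502), line `small-tilt-domination` — integrability of the closure fluxes in `x`

Support file for the crux `…Theses.RelayRaceLocality.NearConstantShortTimeHL`, line `small-tilt-domination`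
(lead c3, wave 2): the registered stubs `integrable_momFlux` and `integrable_enFlux` — for a FIXED configuration
`w` of `n` particles, the two closure-flux integrands of the K-stub defects `momDefect` / `enDefect`,

* `x ↦ Σᵢ Σⱼ c(x)ᵢⱼ · m̃ᵢ m̃ⱼ / ρ̃ + p̃ · d(x)` (momentum flux of the ball averages against continuous coefficients),
* `x ↦ (ẽ + p̃) · Σᵢ (m̃ᵢ / ρ̃) · e(x)ᵢ` (energy flux),

are integrable on `𝕋³`; here `ρ̃ = ρ_w[ballKernel ℓ x]`, `m̃`, `ẽ` are the ball-averaged empirical fields and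
`p̃ = hsPressure σ ρ̃ θ̃`, `θ̃ = (2/3)(ẽ/ρ̃ − ‖m̃‖²/(2ρ̃²))` (Lean's `x / 0 = 0` throughout).

Proof: MEASURABLE — the ball fields are finite sums of (measurable-ball indicator) × constant, and every other
operation (division, `hsCompressibility = 1 + η f_ex′(η)` via `measurable_deriv`) is measurable; BOUNDED — with the
speed bound `‖vᵢ‖ ≤ √(2E(w))`: `ẽ ≤ |V_ℓ⁻¹| E`, `|m̃ᵢ m̃ⱼ / ρ̃| ≤ ‖m̃‖²/ρ̃ ≤ 2ẽ` (Cauchy–Schwarz `norm_ballMomentum_sq_le`),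
`|ρ̃ θ̃| ≤ ẽ`, `‖m̃‖ ≤ √(2E) ρ̃`, and the compressibility factor `Z(ρ̃σ³)` takes only the finitely many values
`Z(j σ³/(n V_ℓ))`, `j ≤ n` (the kernel sum COUNTS the particles in the ball), hence is bounded with no cap at all.
Bounded + measurable on the probability space `𝕋³` ⇒ integrable. The pointwise bounds (`wg_abs_momFlux_le`,
`wg_abs_enFlux_le`) and the parametrised measurability lemmas (`wg_aemeasurable_momFlux_of`, …) are stated for
reuse by the orbit versions (`…FluxIntegrabilityB`).

References: H.-T. Yau, Lett. Math. Phys. 22 (1991) §2; H. Spohn, Large Scale Dynamics of Interacting Particles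
(1991), Part I §3.1 (elementary; folklore).
-/

noncomputable section

namespace Summit.AtomisticToContinuum.HydrodynamicLimit.Theorems.NearConstantShortTimeHL

open scoped BigOperators ENNReal
open MeasureTheory Set Filter
open Literature.MathematicalPhysics.KineticTheory Literature.Analysis.FluidPDE Literature.Analysis.FunctionSpaces

/-! ## Measurability of the ball-averaged fields along measurable parametrisations -/

/-- The minimal-image distance of two measurable torus-valued maps is measurable. [folklore] -/
theorem wg_measurable_euclidDist {α : Type*} [MeasurableSpace α] {X Y : α → T3} (hX : Measurable X)
    (hY : Measurable Y) : Measurable fun a => Torus.euclidDist (X a) (Y a) := by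
  simp only [Torus.euclidDist_eq]
  exact (Torus.measurable_reprSym.comp (hX.sub hY)).norm

/-- The ball kernel evaluated at two measurable torus-valued maps is measurable. [folklore] -/
theorem wg_measurable_ballKernel {α : Type*} [MeasurableSpace α] {X Y : α → T3} (hX : Measurable X)
    (hY : Measurable Y) (ℓ : ℝ) : Measurable fun a => ballKernel ℓ (X a) (Y a) := by
  have hd : Measurable fun a => Torus.euclidDist (X a) (Y a) := wg_measurable_euclidDist hX hY
  have hg : Measurable fun q : ℝ => if q < ℓ then (4 / 3 * Real.pi * ℓ ^ 3)⁻¹ else 0 :=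
    Measurable.ite measurableSet_Iio measurable_const measurable_const
  unfold ballKernel
  exact hg.comp hd

/-- The ball-averaged density of a measurable family of configurations at a measurable centre is measurable.
[folklore] -/
theorem wg_measurable_ballDensity {α : Type*} [MeasurableSpace α] {n : ℕ} {W : α → Config n (Fin 3) T3}
    {X : α → T3} (hW : Measurable W) (hX : Measurable X) (ℓ : ℝ) :
    Measurable fun a => empiricalDensityField (W a) (ballKernel ℓ (X a)) := by
  simp_rw [empiricalDensityField_eq_sum]
  exact (Finset.measurable_sum _ fun i _ =>
    wg_measurable_ballKernel hX ((measurable_pi_apply i).comp hW).fst ℓ).const_mul _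

/-- The ball-averaged momentum of a measurable family of configurations at a measurable centre is measurable.
[folklore] -/
theorem wg_measurable_ballMomentum {α : Type*} [MeasurableSpace α] {n : ℕ} {W : α → Config n (Fin 3) T3}
    {X : α → T3} (hW : Measurable W) (hX : Measurable X) (ℓ : ℝ) :
    Measurable fun a => empiricalMomentumField (W a) (ballKernel ℓ (X a)) := by
  simp_rw [empiricalMomentumField_eq_sum]
  refine Measurable.fun_const_smul ?_ _
  exact Finset.measurable_sum _ fun i _ =>
    (wg_measurable_ballKernel hX ((measurable_pi_apply i).comp hW).fst ℓ).smul ((measurable_pi_apply i).comp hW).snd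

/-- The ball-averaged energy of a measurable family of configurations at a measurable centre is measurable.
[folklore] -/
theorem wg_measurable_ballEnergy {α : Type*} [MeasurableSpace α] {n : ℕ} {W : α → Config n (Fin 3) T3}
    {X : α → T3} (hW : Measurable W) (hX : Measurable X) (ℓ : ℝ) :
    Measurable fun a => empiricalEnergyField (W a) (ballKernel ℓ (X a)) := by
  simp_rw [empiricalEnergyField_eq_sum]
  refine Measurable.const_mul ?_ _
  exact Finset.measurable_sum _ fun i _ => (wg_measurable_ballKernel hX ((measurable_pi_apply i).comp hW).fst ℓ).mul
    ((((measurable_pi_apply i).comp hW).snd.norm.pow_const 2).div_const 2)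

/-- The hard-sphere pressure law `(ρ, θ) ↦ ρ θ Z(ρσ³)` is (jointly Borel) measurable — `Z = 1 + η f_ex′(η)` with
Mathlib's everywhere-defined `deriv`, which is measurable (`measurable_deriv`). [folklore] -/
theorem wg_measurable_hsPressure (σ : ℝ) : Measurable fun p : ℝ × ℝ => hsPressure σ p.1 p.2 := by
  unfold hsPressure hsCompressibility
  have h1 : Measurable fun p : ℝ × ℝ => p.1 * σ ^ 3 := measurable_fst.mul_const _
  have h2 : Measurable fun p : ℝ × ℝ => deriv hsExcessFreeEnergy (p.1 * σ ^ 3) :=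
    (measurable_deriv _).comp h1
  exact (measurable_fst.mul measurable_snd).mul (measurable_const.add (h1.mul h2))

/-- Coordinates of a measurable `ℝ³`-valued map are measurable. [folklore] -/
theorem wg_measurable_V3_apply {α : Type*} [MeasurableSpace α] {m : α → V3} (hm : Measurable m) (j : Fin 3) :
    Measurable fun a => m a j := by
  fun_prop

/-- A.e.-measurability of the MOMENTUM-flux integrand built from measurable fields `ρt, mt, et` and
a.e.-measurable coefficients `C i j`, `D`. [folklore] -/
theorem wg_aemeasurable_momFlux_of {α : Type*} [MeasurableSpace α] {μ : Measure α} (σ : ℝ)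
    {ρt et D : α → ℝ} {mt : α → V3} {C : Fin 3 → Fin 3 → α → ℝ}
    (hρ : Measurable ρt) (hm : Measurable mt) (he : Measurable et)
    (hC : ∀ i j, AEMeasurable (C i j) μ) (hD : AEMeasurable D μ) :
    AEMeasurable (fun a => (∑ i, ∑ j, C i j a * (mt a i * mt a j / ρt a)) +
      hsPressure σ (ρt a) (2 / 3 * (et a / ρt a - ‖mt a‖ ^ 2 / (2 * ρt a ^ 2))) * D a) μ := by
  have hθ : Measurable fun a => 2 / 3 * (et a / ρt a - ‖mt a‖ ^ 2 / (2 * ρt a ^ 2)) := by fun_prop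
  have hp : Measurable fun a => hsPressure σ (ρt a) (2 / 3 * (et a / ρt a - ‖mt a‖ ^ 2 / (2 * ρt a ^ 2))) :=
    (wg_measurable_hsPressure σ).comp (hρ.prodMk hθ)
  have hmj : ∀ j, Measurable fun a => mt a j := fun j => wg_measurable_V3_apply hm j
  refine AEMeasurable.add ?_ (hp.aemeasurable.mul hD)
  refine Finset.aemeasurable_fun_sum _ fun i _ => Finset.aemeasurable_fun_sum _ fun j _ => (hC i j).mul ?_
  exact (((hmj i).mul (hmj j)).div hρ).aemeasurable

/-- A.e.-measurability of the ENERGY-flux integrand built from measurable fields `ρt, mt, et` and a.e.-measurable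
coefficients `E i`. [folklore] -/
theorem wg_aemeasurable_enFlux_of {α : Type*} [MeasurableSpace α] {μ : Measure α} (σ : ℝ)
    {ρt et : α → ℝ} {mt : α → V3} {E : Fin 3 → α → ℝ}
    (hρ : Measurable ρt) (hm : Measurable mt) (he : Measurable et)
    (hE : ∀ i, AEMeasurable (E i) μ) :
    AEMeasurable (fun a => (et a + hsPressure σ (ρt a) (2 / 3 * (et a / ρt a - ‖mt a‖ ^ 2 / (2 * ρt a ^ 2)))) *
      (∑ i, (mt a i / ρt a) * E i a)) μ := by
  have hθ : Measurable fun a => 2 / 3 * (et a / ρt a - ‖mt a‖ ^ 2 / (2 * ρt a ^ 2)) := by fun_prop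
  have hp : Measurable fun a => hsPressure σ (ρt a) (2 / 3 * (et a / ρt a - ‖mt a‖ ^ 2 / (2 * ρt a ^ 2))) :=
    (wg_measurable_hsPressure σ).comp (hρ.prodMk hθ)
  have hmj : ∀ j, Measurable fun a => mt a j := fun j => wg_measurable_V3_apply hm j
  refine (he.add hp).aemeasurable.mul ?_
  exact Finset.aemeasurable_fun_sum _ fun i _ => (((hmj i).div hρ).aemeasurable.mul (hE i))

/-! ## Pointwise bounds on the ball-averaged fields and the fluxes -/

/-- The ball kernel is bounded by `|V_ℓ⁻¹|`, `V_ℓ = (4/3)πℓ³` (any `ℓ`). [folklore] -/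
theorem wg_ballKernel_le (ℓ : ℝ) (x y : T3) : ballKernel ℓ x y ≤ |(4 / 3 * Real.pi * ℓ ^ 3)⁻¹| := by
  unfold ballKernel
  split_ifs
  · exact le_abs_self _
  · exact abs_nonneg _

/-- An average of `n` numbers each `≤ C` (`C ≥ 0`) is `≤ C` (also for `n = 0`, where the average is `0`). [folklore] -/
theorem wg_avg_le {n : ℕ} {a : Fin n → ℝ} {C : ℝ} (h : ∀ i, a i ≤ C) (hC : 0 ≤ C) :
    (n : ℝ)⁻¹ * ∑ i, a i ≤ C := by
  rcases Nat.eq_zero_or_pos n with hn | hn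
  · subst hn
    simp [hC]
  · have hn' : (0 : ℝ) < n := by exact_mod_cast hn
    rw [inv_mul_le_iff₀ hn']
    calc ∑ i, a i ≤ ∑ _i : Fin n, C := Finset.sum_le_sum fun i _ => h i
      _ = n * C := by simp

/-- Each speed of a configuration is at most `√(2E(w))`, `E` the kinetic energy `configEnergy`. [folklore] -/
theorem wg_norm_vel_le {n : ℕ} (w : Config n (Fin 3) T3) (i : Fin n) :
    ‖(w i).2‖ ≤ Real.sqrt (2 * configEnergy w) := by
  have h := Real.abs_le_sqrt (norm_vel_sq_le_two_mul_configEnergy w i)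
  rwa [abs_of_nonneg (norm_nonneg _)] at h

/-- Under a speed bound `‖vᵢ‖ ≤ Cv` the ball-averaged energy is at most `|V_ℓ⁻¹| Cv²/2`. [folklore] -/
theorem wg_ballEnergy_le {n : ℕ} (ℓ : ℝ) (x : T3) (w : Config n (Fin 3) T3) {Cv : ℝ}
    (hv : ∀ i, ‖(w i).2‖ ≤ Cv) :
    empiricalEnergyField w (ballKernel ℓ x) ≤ |(4 / 3 * Real.pi * ℓ ^ 3)⁻¹| * (Cv ^ 2 / 2) := by
  rw [empiricalEnergyField_eq_sum]
  refine wg_avg_le (fun i => ?_) (by positivity)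
  have h1 : ‖(w i).2‖ ^ 2 ≤ Cv ^ 2 := pow_le_pow_left₀ (norm_nonneg _) (hv i) 2
  exact mul_le_mul (wg_ballKernel_le ℓ x _) (by linarith) (by positivity) (abs_nonneg _)

/-- Under a speed bound `‖vᵢ‖ ≤ Cv` the ball-averaged momentum is dominated by the density: `‖m̃‖ ≤ Cv ρ̃`.
[folklore] -/
theorem wg_norm_ballMomentum_le {n : ℕ} (ℓ : ℝ) (x : T3) (w : Config n (Fin 3) T3) {Cv : ℝ}
    (hv : ∀ i, ‖(w i).2‖ ≤ Cv) :
    ‖empiricalMomentumField w (ballKernel ℓ x)‖ ≤ Cv * empiricalDensityField w (ballKernel ℓ x) := by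
  refine (norm_ballMomentum_le_sum ℓ x w).trans ?_
  rw [empiricalDensityField_eq_sum, Finset.mul_sum, Finset.mul_sum, Finset.mul_sum]
  refine Finset.sum_le_sum fun i _ => ?_
  have h := mul_le_mul_of_nonneg_left (hv i) (ballKernel_nonneg ℓ x (w i).1)
  nlinarith [inv_nonneg.2 (Nat.cast_nonneg n : (0 : ℝ) ≤ n), h, ballKernel_nonneg ℓ x (w i).1]

/-- **The ball-averaged density takes finitely many values**: `ρ̃ = j / (n V_ℓ)` with `j ≤ n` the number of particles
in the ball. [folklore] -/
theorem wg_ballDensity_eq_card {n : ℕ} (ℓ : ℝ) (x : T3) (w : Config n (Fin 3) T3) :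
    ∃ j ∈ Finset.range (n + 1), empiricalDensityField w (ballKernel ℓ x) =
      (n : ℝ)⁻¹ * (j * (4 / 3 * Real.pi * ℓ ^ 3)⁻¹) := by
  classical
  refine ⟨(Finset.univ.filter fun i : Fin n => Torus.euclidDist x (w i).1 < ℓ).card,
    Finset.mem_range.2 (Nat.lt_succ_of_le ?_), ?_⟩
  · exact (Finset.card_filter_le _ _).trans (by simp)
  · rw [empiricalDensityField_eq_sum]
    congr 1
    simp only [ballKernel]
    rw [Finset.sum_ite, Finset.sum_const_zero, add_zero, Finset.sum_const, nsmul_eq_mul]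

/-- Hence the compressibility factor at the ball-averaged density is bounded by the finite sum of its values
`Σ_{j ≤ n} |Z(j σ³ / (n V_ℓ))|` — no packing cap needed. [folklore] -/
theorem wg_abs_compress_le {n : ℕ} (σ ℓ : ℝ) (x : T3) (w : Config n (Fin 3) T3) :
    |hsCompressibility (empiricalDensityField w (ballKernel ℓ x) * σ ^ 3)| ≤
      ∑ j ∈ Finset.range (n + 1),
        |hsCompressibility ((n : ℝ)⁻¹ * (j * (4 / 3 * Real.pi * ℓ ^ 3)⁻¹) * σ ^ 3)| := by
  obtain ⟨j, hj, heq⟩ := wg_ballDensity_eq_card ℓ x w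
  rw [heq]
  exact Finset.single_le_sum
    (f := fun j : ℕ => |hsCompressibility ((n : ℝ)⁻¹ * (j * (4 / 3 * Real.pi * ℓ ^ 3)⁻¹) * σ ^ 3)|)
    (fun _ _ => abs_nonneg _) hj

/-- The convective momentum flux of the ball averages is dominated by the energy: `|m̃ᵢ m̃ⱼ / ρ̃| ≤ 2ẽ`
(Cauchy–Schwarz `‖m̃‖² ≤ 2ρ̃ẽ`; `0` on empty balls by `x / 0 = 0`). [folklore] -/
theorem wg_abs_momProd_div_le {n : ℕ} (ℓ : ℝ) (x : T3) (w : Config n (Fin 3) T3) (i j : Fin 3) :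
    |empiricalMomentumField w (ballKernel ℓ x) i * empiricalMomentumField w (ballKernel ℓ x) j /
        empiricalDensityField w (ballKernel ℓ x)| ≤ 2 * empiricalEnergyField w (ballKernel ℓ x) := by
  have hE := ballEnergy_nonneg ℓ x w
  rcases (ballDensity_nonneg ℓ x w).eq_or_lt with hρ | hρ
  · rw [← hρ, div_zero, abs_zero]
    linarith
  · rw [abs_div, abs_mul, abs_of_pos hρ, div_le_iff₀ hρ]
    have hi : |empiricalMomentumField w (ballKernel ℓ x) i| ≤ ‖empiricalMomentumField w (ballKernel ℓ x)‖ :=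
      (Real.norm_eq_abs _).symm.le.trans (PiLp.norm_apply_le _ i)
    have hj : |empiricalMomentumField w (ballKernel ℓ x) j| ≤ ‖empiricalMomentumField w (ballKernel ℓ x)‖ :=
      (Real.norm_eq_abs _).symm.le.trans (PiLp.norm_apply_le _ j)
    have hsq := norm_ballMomentum_sq_le ℓ x w
    calc |empiricalMomentumField w (ballKernel ℓ x) i| * |empiricalMomentumField w (ballKernel ℓ x) j|
        ≤ ‖empiricalMomentumField w (ballKernel ℓ x)‖ * ‖empiricalMomentumField w (ballKernel ℓ x)‖ :=
          mul_le_mul hi hj (abs_nonneg _) (norm_nonneg _)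
      _ = ‖empiricalMomentumField w (ballKernel ℓ x)‖ ^ 2 := (sq _).symm
      _ ≤ 2 * empiricalEnergyField w (ballKernel ℓ x) * empiricalDensityField w (ballKernel ℓ x) := by
          linarith

/-- Under a speed bound `‖vᵢ‖ ≤ Cv` (`Cv ≥ 0`) the local velocity of the ball averages is bounded:
`|m̃ᵢ / ρ̃| ≤ Cv`. [folklore] -/
theorem wg_abs_mom_div_le {n : ℕ} (ℓ : ℝ) (x : T3) (w : Config n (Fin 3) T3) {Cv : ℝ} (hCv : 0 ≤ Cv)
    (hv : ∀ i, ‖(w i).2‖ ≤ Cv) (i : Fin 3) :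
    |empiricalMomentumField w (ballKernel ℓ x) i / empiricalDensityField w (ballKernel ℓ x)| ≤ Cv := by
  rcases (ballDensity_nonneg ℓ x w).eq_or_lt with hρ | hρ
  · rw [← hρ, div_zero, abs_zero]
    exact hCv
  · rw [abs_div, abs_of_pos hρ, div_le_iff₀ hρ]
    exact ((Real.norm_eq_abs _).symm.le.trans (PiLp.norm_apply_le _ i)).trans (wg_norm_ballMomentum_le ℓ x w hv)

/-- **Pressure of the ball averages is dominated by the energy**: `|p̃| ≤ ẽ · Σ_{j ≤ n} |Z(jσ³/(nV_ℓ))|`, since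
`p̃ = (ρ̃θ̃) Z(ρ̃σ³)` with `ρ̃θ̃ = (2/3)(ẽ − ‖m̃‖²/(2ρ̃)) ∈ [0, ẽ]`. [folklore] -/
theorem wg_abs_pressure_le {n : ℕ} (σ ℓ : ℝ) (x : T3) (w : Config n (Fin 3) T3) :
    |hsPressure σ (empiricalDensityField w (ballKernel ℓ x))
        (2 / 3 * (empiricalEnergyField w (ballKernel ℓ x) / empiricalDensityField w (ballKernel ℓ x) -
          ‖empiricalMomentumField w (ballKernel ℓ x)‖ ^ 2 / (2 * empiricalDensityField w (ballKernel ℓ x) ^ 2)))| ≤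
      empiricalEnergyField w (ballKernel ℓ x) *
        ∑ j ∈ Finset.range (n + 1),
          |hsCompressibility ((n : ℝ)⁻¹ * (j * (4 / 3 * Real.pi * ℓ ^ 3)⁻¹) * σ ^ 3)| := by
  have hE := ballEnergy_nonneg ℓ x w
  have hZ := wg_abs_compress_le σ ℓ x w
  unfold hsPressure
  rw [abs_mul]
  refine mul_le_mul ?_ hZ (abs_nonneg _) hE
  rcases (ballDensity_nonneg ℓ x w).eq_or_lt with hρ | hρ
  · rw [← hρ, zero_mul, abs_zero]
    exact hE
  · have hsq := norm_ballMomentum_sq_le ℓ x w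
    have h1 : empiricalDensityField w (ballKernel ℓ x) *
        (2 / 3 * (empiricalEnergyField w (ballKernel ℓ x) / empiricalDensityField w (ballKernel ℓ x) -
          ‖empiricalMomentumField w (ballKernel ℓ x)‖ ^ 2 / (2 * empiricalDensityField w (ballKernel ℓ x) ^ 2))) =
        2 / 3 * (empiricalEnergyField w (ballKernel ℓ x) -
          ‖empiricalMomentumField w (ballKernel ℓ x)‖ ^ 2 / (2 * empiricalDensityField w (ballKernel ℓ x))) := by
      field_simp
    have h2 : 0 ≤ ‖empiricalMomentumField w (ballKernel ℓ x)‖ ^ 2 / (2 * empiricalDensityField w (ballKernel ℓ x)) := by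
      positivity
    have h3 : ‖empiricalMomentumField w (ballKernel ℓ x)‖ ^ 2 / (2 * empiricalDensityField w (ballKernel ℓ x)) ≤
        empiricalEnergyField w (ballKernel ℓ x) := by
      rw [div_le_iff₀ (by positivity)]
      linarith
    rw [h1, abs_le]
    constructor <;> nlinarith

/-- **Pointwise bound on the momentum-flux integrand.** With speeds `≤ Cv`, coefficients `|cᵢⱼ| ≤ Cc`, `|d| ≤ Cd`:
`|Σᵢⱼ cᵢⱼ m̃ᵢm̃ⱼ/ρ̃ + p̃ d| ≤ (18 Cc + CZ Cd) |V_ℓ⁻¹| Cv²/2`, `CZ = Σ_{j ≤ n} |Z(jσ³/(nV_ℓ))|`. [folklore] -/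
theorem wg_abs_momFlux_le {n : ℕ} (σ ℓ : ℝ) (x : T3) (w : Config n (Fin 3) T3) {Cv Cc Cd : ℝ}
    (hv : ∀ i, ‖(w i).2‖ ≤ Cv) (c : Fin 3 → Fin 3 → ℝ) (d : ℝ) (hc : ∀ i j, |c i j| ≤ Cc) (hd : |d| ≤ Cd) :
    |(∑ i, ∑ j, c i j * (empiricalMomentumField w (ballKernel ℓ x) i * empiricalMomentumField w (ballKernel ℓ x) j /
        empiricalDensityField w (ballKernel ℓ x))) +
      hsPressure σ (empiricalDensityField w (ballKernel ℓ x))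
        (2 / 3 * (empiricalEnergyField w (ballKernel ℓ x) / empiricalDensityField w (ballKernel ℓ x) -
          ‖empiricalMomentumField w (ballKernel ℓ x)‖ ^ 2 / (2 * empiricalDensityField w (ballKernel ℓ x) ^ 2))) * d| ≤
      (18 * Cc + (∑ j ∈ Finset.range (n + 1),
          |hsCompressibility ((n : ℝ)⁻¹ * (j * (4 / 3 * Real.pi * ℓ ^ 3)⁻¹) * σ ^ 3)|) * Cd) *
        (|(4 / 3 * Real.pi * ℓ ^ 3)⁻¹| * (Cv ^ 2 / 2)) := by
  have hE := ballEnergy_nonneg ℓ x w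
  have hEle := wg_ballEnergy_le ℓ x w hv
  have hCc : 0 ≤ Cc := (abs_nonneg _).trans (hc 0 0)
  have hCd : 0 ≤ Cd := (abs_nonneg _).trans hd
  have hCZ : 0 ≤ ∑ j ∈ Finset.range (n + 1),
      |hsCompressibility ((n : ℝ)⁻¹ * (j * (4 / 3 * Real.pi * ℓ ^ 3)⁻¹) * σ ^ 3)| :=
    Finset.sum_nonneg fun _ _ => abs_nonneg _
  have h1 : |∑ i, ∑ j, c i j * (empiricalMomentumField w (ballKernel ℓ x) i *
      empiricalMomentumField w (ballKernel ℓ x) j / empiricalDensityField w (ballKernel ℓ x))| ≤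
      18 * Cc * empiricalEnergyField w (ballKernel ℓ x) := by
    refine (Finset.abs_sum_le_sum_abs _ _).trans ?_
    refine (Finset.sum_le_sum fun i _ => Finset.abs_sum_le_sum_abs _ _).trans ?_
    calc ∑ i, ∑ j, |c i j * (empiricalMomentumField w (ballKernel ℓ x) i *
          empiricalMomentumField w (ballKernel ℓ x) j / empiricalDensityField w (ballKernel ℓ x))|
        ≤ ∑ _i : Fin 3, ∑ _j : Fin 3, Cc * (2 * empiricalEnergyField w (ballKernel ℓ x)) :=
          Finset.sum_le_sum fun i _ => Finset.sum_le_sum fun j _ => by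
            rw [abs_mul]
            exact mul_le_mul (hc i j) (wg_abs_momProd_div_le ℓ x w i j) (abs_nonneg _) hCc
      _ = 18 * Cc * empiricalEnergyField w (ballKernel ℓ x) := by
          simp only [Finset.sum_const, Finset.card_univ, Fintype.card_fin, nsmul_eq_mul, Nat.cast_ofNat]
          ring
  have h2 := wg_abs_pressure_le σ ℓ x w
  refine (abs_add_le _ _).trans ?_
  rw [abs_mul]
  calc _ ≤ 18 * Cc * empiricalEnergyField w (ballKernel ℓ x) + empiricalEnergyField w (ballKernel ℓ x) *
        (∑ j ∈ Finset.range (n + 1),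
          |hsCompressibility ((n : ℝ)⁻¹ * (j * (4 / 3 * Real.pi * ℓ ^ 3)⁻¹) * σ ^ 3)|) * Cd :=
        add_le_add h1 (mul_le_mul h2 hd (abs_nonneg _) (mul_nonneg hE hCZ))
    _ = (18 * Cc + (∑ j ∈ Finset.range (n + 1),
          |hsCompressibility ((n : ℝ)⁻¹ * (j * (4 / 3 * Real.pi * ℓ ^ 3)⁻¹) * σ ^ 3)|) * Cd) *
        empiricalEnergyField w (ballKernel ℓ x) := by ring
    _ ≤ _ := mul_le_mul_of_nonneg_left hEle (by positivity)

/-- **Pointwise bound on the energy-flux integrand.** With speeds `≤ Cv` (`Cv ≥ 0`) and coefficients `|eᵢ| ≤ Ce`: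
`|(ẽ + p̃) Σᵢ (m̃ᵢ/ρ̃) eᵢ| ≤ |V_ℓ⁻¹| Cv²/2 · (1 + CZ) · 3 Cv Ce`. [folklore] -/
theorem wg_abs_enFlux_le {n : ℕ} (σ ℓ : ℝ) (x : T3) (w : Config n (Fin 3) T3) {Cv Ce : ℝ} (hCv : 0 ≤ Cv)
    (hv : ∀ i, ‖(w i).2‖ ≤ Cv) (e : Fin 3 → ℝ) (he : ∀ i, |e i| ≤ Ce) :
    |(empiricalEnergyField w (ballKernel ℓ x) + hsPressure σ (empiricalDensityField w (ballKernel ℓ x))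
        (2 / 3 * (empiricalEnergyField w (ballKernel ℓ x) / empiricalDensityField w (ballKernel ℓ x) -
          ‖empiricalMomentumField w (ballKernel ℓ x)‖ ^ 2 / (2 * empiricalDensityField w (ballKernel ℓ x) ^ 2)))) *
      (∑ i, (empiricalMomentumField w (ballKernel ℓ x) i / empiricalDensityField w (ballKernel ℓ x)) * e i)| ≤
      (|(4 / 3 * Real.pi * ℓ ^ 3)⁻¹| * (Cv ^ 2 / 2)) *
        (1 + ∑ j ∈ Finset.range (n + 1),
          |hsCompressibility ((n : ℝ)⁻¹ * (j * (4 / 3 * Real.pi * ℓ ^ 3)⁻¹) * σ ^ 3)|) * (3 * (Cv * Ce)) := by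
  have hE := ballEnergy_nonneg ℓ x w
  have hEle := wg_ballEnergy_le ℓ x w hv
  have hCe : 0 ≤ Ce := (abs_nonneg _).trans (he 0)
  have hCZ : 0 ≤ ∑ j ∈ Finset.range (n + 1),
      |hsCompressibility ((n : ℝ)⁻¹ * (j * (4 / 3 * Real.pi * ℓ ^ 3)⁻¹) * σ ^ 3)| :=
    Finset.sum_nonneg fun _ _ => abs_nonneg _
  have h1 := (abs_add_le _ _).trans (add_le_add (abs_of_nonneg hE).le (wg_abs_pressure_le σ ℓ x w))
  have h2 : |∑ i, (empiricalMomentumField w (ballKernel ℓ x) i / empiricalDensityField w (ballKernel ℓ x)) * e i| ≤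
      3 * (Cv * Ce) := by
    refine (Finset.abs_sum_le_sum_abs _ _).trans ?_
    calc ∑ i, |(empiricalMomentumField w (ballKernel ℓ x) i / empiricalDensityField w (ballKernel ℓ x)) * e i|
        ≤ ∑ _i : Fin 3, Cv * Ce := Finset.sum_le_sum fun i _ => by
          rw [abs_mul]
          exact mul_le_mul (wg_abs_mom_div_le ℓ x w hCv hv i) (he i) (abs_nonneg _) hCv
      _ = 3 * (Cv * Ce) := by
          simp only [Finset.sum_const, Finset.card_univ, Fintype.card_fin, nsmul_eq_mul, Nat.cast_ofNat]
  rw [abs_mul]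
  calc _ ≤ (empiricalEnergyField w (ballKernel ℓ x) + empiricalEnergyField w (ballKernel ℓ x) *
        ∑ j ∈ Finset.range (n + 1),
          |hsCompressibility ((n : ℝ)⁻¹ * (j * (4 / 3 * Real.pi * ℓ ^ 3)⁻¹) * σ ^ 3)|) * (3 * (Cv * Ce)) :=
        mul_le_mul h1 h2 (abs_nonneg _) (by positivity)
    _ = empiricalEnergyField w (ballKernel ℓ x) * (1 + ∑ j ∈ Finset.range (n + 1),
          |hsCompressibility ((n : ℝ)⁻¹ * (j * (4 / 3 * Real.pi * ℓ ^ 3)⁻¹) * σ ^ 3)|) * (3 * (Cv * Ce)) := by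
        ring
    _ ≤ _ := by
        refine mul_le_mul_of_nonneg_right (mul_le_mul_of_nonneg_right hEle (by positivity)) (by positivity)

/-! ## The registered stubs -/

/-- **Registered stub `integrable_momFlux`.** For a fixed configuration `w`, any `σ, ℓ` and continuous coefficients
`c, d`, the momentum-flux integrand `x ↦ Σᵢⱼ c(x)ᵢⱼ m̃ᵢm̃ⱼ/ρ̃ + p̃ d(x)` of `momDefect` is integrable on `𝕋³`
(measurable and bounded on a probability space). [cite: Yau1991, §2] -/
theorem integrable_momFlux : ∀ (σ ℓ : ℝ) {n : ℕ} (w : Config n (Fin 3) T3) {c : T3 → Fin 3 → Fin 3 → ℝ} {d : T3 → ℝ}, (∀ i j, Continuous fun x => c x i j) → Continuous d → Integrable (fun x => (∑ i, ∑ j, c x i j * (empiricalMomentumField w (ballKernel ℓ x) i * empiricalMomentumField w (ballKernel ℓ x) j / empiricalDensityField w (ballKernel ℓ x))) + hsPressure σ (empiricalDensityField w (ballKernel ℓ x)) (2 / 3 * (empiricalEnergyField w (ballKernel ℓ x) / empiricalDensityField w (ballKernel ℓ x) - ‖empiricalMomentumField w (ballKernel ℓ x)‖ ^ 2 / (2 *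 empiricalDensityField w (ballKernel ℓ x) ^ 2))) * d x) := by
  intro σ ℓ n w c d hc hd
  have hcont : Continuous c := continuous_pi fun i => continuous_pi fun j => hc i j
  obtain ⟨Cc, hCc⟩ := isCompact_univ.exists_bound_of_continuousOn hcont.continuousOn
  obtain ⟨Cd, hCd⟩ := isCompact_univ.exists_bound_of_continuousOn hd.continuousOn
  have hc' : ∀ x i j, |c x i j| ≤ Cc := fun x i j =>
    (Real.norm_eq_abs _).symm.le.trans
      (((norm_le_pi_norm (c x i) j).trans (norm_le_pi_norm (c x) i)).trans (hCc x (mem_univ x)))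
  have hd' : ∀ x, |d x| ≤ Cd := fun x => (Real.norm_eq_abs _).symm.le.trans (hCd x (mem_univ x))
  refine Integrable.of_bound ?_ _ (ae_of_all _ fun x => (Real.norm_eq_abs _).trans_le
    (wg_abs_momFlux_le σ ℓ x w (fun i => wg_norm_vel_le w i) (c x) (d x) (hc' x) (hd' x)))
  exact (wg_aemeasurable_momFlux_of σ (C := fun i j x => c x i j)
    (wg_measurable_ballDensity (W := fun _ => w) measurable_const measurable_id ℓ)
    (wg_measurable_ballMomentum (W := fun _ => w) measurable_const measurable_id ℓ)
    (wg_measurable_ballEnergy (W := fun _ => w) measurable_const measurable_id ℓ)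
    (fun i j => (hc i j).measurable.aemeasurable) hd.measurable.aemeasurable).aestronglyMeasurable

/-- **Registered stub `integrable_enFlux`.** For a fixed configuration `w`, any `σ, ℓ` and a continuous vector
coefficient `e`, the energy-flux integrand `x ↦ (ẽ + p̃) Σᵢ (m̃ᵢ/ρ̃) e(x)ᵢ` of `enDefect` is integrable on `𝕋³`.
[cite: Yau1991, §2] -/
theorem integrable_enFlux : ∀ (σ ℓ : ℝ) {n : ℕ} (w : Config n (Fin 3) T3) {e : T3 → V3}, Continuous e → Integrable (fun x => (empiricalEnergyField w (ballKernel ℓ x) + hsPressure σ (empiricalDensityField w (ballKernel ℓ x)) (2 / 3 * (empiricalEnergyField w (ballKernel ℓ x) / empiricalDensityField w (ballKernel ℓ x) - ‖empiricalMomentumField w (ballKernel ℓ x)‖ ^ 2 / (2 * empiricalDensityField w (ballKernel ℓ x) ^ 2)))) * (∑ i, (empiricalMomentumField w (ballKernel ℓ x) i / empiricalDensityField w (ballKernel ℓ x)) * e x i)) := by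
  intro σ ℓ n w e he
  obtain ⟨Ce, hCe⟩ := isCompact_univ.exists_bound_of_continuousOn he.continuousOn
  have he' : ∀ x i, |e x i| ≤ Ce := fun x i =>
    (Real.norm_eq_abs _).symm.le.trans ((PiLp.norm_apply_le (e x) i).trans (hCe x (mem_univ x)))
  refine Integrable.of_bound ?_ _ (ae_of_all _ fun x => (Real.norm_eq_abs _).trans_le
    (wg_abs_enFlux_le σ ℓ x w (Real.sqrt_nonneg _) (fun i => wg_norm_vel_le w i) (e x) (he' x)))
  exact (wg_aemeasurable_enFlux_of σ (E := fun i x => e x i)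
    (wg_measurable_ballDensity (W := fun _ => w) measurable_const measurable_id ℓ)
    (wg_measurable_ballMomentum (W := fun _ => w) measurable_const measurable_id ℓ)
    (wg_measurable_ballEnergy (W := fun _ => w) measurable_const measurable_id ℓ)
    (fun i => (wg_measurable_V3_apply he.measurable i).aemeasurable)).aestronglyMeasurable

end Summit.AtomisticToContinuum.HydrodynamicLimit.Theorems.NearConstantShortTimeHL

end
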